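import Literature.NumberTheory.LFunctions.RodgersTaoZeroDynamics
import Literature.NumberTheory.LFunctions.RodgersTaoNotation
import Literature.NumberTheory.LFunctions.DobnerLemma4Proofs
import HarnessLib

/-!
# Rodgers–Tao 2020, §5 (a weak bound on gaps) and §6 (a weak bound on integrated energy)

VACUOUS-AS-PRINTED(Λ ≥ 0) corpus typing (cell rh-crit, corpus C3 = Rodgers–Tao/Dobner, typer t4):
the three numbered statements of §§5–6 are printed under the standing hypothesis `Λ < 0` of
§1.2 and are therefore EX-FALSO class in a tree that proves `Λ ≥ 0` (`rodgers_tao_holds`); they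
are typed here AS PRINTED, in the cell's house witness form, and nothing in this file is worded
as content about `H_t`. Trunk T-ANT (`Literature/NumberTheory/LFunctions`).

Source: B. Rodgers, T. Tao, *The de Bruijn–Newman constant is non-negative*, Forum Math. Pi 8
(2020) e6 = arXiv:1801.05914. Statement numbers are those of arXiv v4 (section-numbered, as in
the tree's other Rodgers–Tao files), with the consecutive numbering of arXiv v5 = the published
version (FMP) alongside: Proposition 5.1 = Prop. 13 (FMP p. 34, display (59)), Lemma 5.2 =
Lemma 14 (FMP p. 35), Proposition 6.1 = Prop. 15 (FMP p. 38). The three statements are verbatim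
identical in arXiv v2/v4/v5 and FMP (cell concordance `rt/RT-VERSIONS-lit-1.md` §2); equation
numbers (50)–(60) agree in all versions.

## Contents (namespace `Literature.NumberTheory.LFunctions`)

* `interactionEnergyDyadicSum t J` — the truncation `Σ_{J ≤ j < k ≤ 2J} E_{jk}(t)` integrated in
  Prop. 6.1 (a finite sum of the tree's `interactionEnergy`, display (58), over the tree's
  discrete interval `zstarIcc ⌈J⌉ ⌊2J⌋ = [J, 2J]_{ℤ*}`), with `interactionEnergyDyadicSum_nonneg`.
* NAMED FACTS (D-0014; users take `(h : X)`):
  `rodgers_tao_gap_bound` — Prop. 5.1 (lower bound on gaps);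
  `rodgers_tao_gap_cross_energy` — Lemma 5.2;
  `rodgers_tao_weak_energy_bound` — Prop. 6.1 (weak bound on integrated energy);
  each followed, in the last section, by its EX-FALSO `_holds` (0 content: the witness hypothesis
  is refuted by the tree's `rodgers_tao_holds`), recorded only so that these vacuous-as-printed
  statements never enter the literature-debt queue (cell ruling R2 (2); the same treatment as
  §3's Thm. 3.2 / Cor. 3.3 in `RodgersTaoRiemannVonMangoldt.lean`). They must never be cited as
  «Prop. 5.1 / Lemma 5.2 / Prop. 6.1 formalised».

The objects the statements are written in are the tree's (cell ruling R1, first-filed wins):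
`deBruijnZeroZ t j` = `x_j(t)`, `j ∈ ℤ* = ℤ ∖ {0}` (§1.2), `hamiltonianInteraction t j k` =
`H_{jk}(t)` (57), `interactionEnergy t j k` = `E_{jk}(t)` (58), `zstarIcc a b` = `[a, b]_{ℤ*}`,
`zstarCompl K` = `ℤ* ∖ K` (all `RodgersTaoZeroDynamics.lean`), `logPlus x` = `log₊ x = log(2 + |x|)`
(§1.2; `RodgersTaoNotation.lean`). Nothing of theirs is redeclared.

## Typed time range: the house witness form (cell ruling R2; `RodgersTaoEnergyV5.lean`, Conventions)

Each statement is printed for `Λ/2 ≤ t ≤ 0` under §1.2's «we will assume for sake of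
contradiction that Newman's conjecture fails: `Λ < 0`». As in the tree's §8 files, `Λ < 0` is
carried by a WITNESS `t₀ < 0` with `H_{t₀}` real-rooted (so `Λ ≤ t₀ < 0`, by
`hasOnlyRealZeros_deBruijnH_iff_deBruijnNewmanConst_le_holds`), and `Λ/2 ≤ t ≤ 0` becomes
`t₀/2 ≤ t ≤ 0`; the implied constants may depend on the witness as the printed ones depend on `Λ`
(§1.2: "as `Λ` is also an absolute constant, `C` can certainly depend on `Λ`"). Since `H_Λ` is
itself real-rooted (`hasOnlyRealZeros_deBruijnH_deBruijnNewmanConst`), the instance `t₀ = Λ` is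
the printed statement verbatim and every other instance is a sub-range of it: the encoding is
faithful, neither stronger nor weaker. The upper bound `t ≤ 0` is kept as printed (ruling R2 (1):
RT Remark 2.2 extends only Lemma 2.1 below `Λ`, "in contrast to the remaining arguments in this
paper", and the proofs of §§5–6 consume Cor. 3.3 / displays (50)–(52) at `t ≤ 0`). LABEL of all
three facts: VACUOUS-AS-PRINTED(Λ ≥ 0) — the witness hypothesis is refuted by the tree's
`rodgers_tao_holds`, so their `_holds` below are EX-FALSO (0 content) and say so.

## Rendering choices (each repeated in the docstring it affects)

* `X ≪ Y` (§1.2: `|X| ≤ CY`, `C` absolute) is rendered ONE-SIDED in the direction each statement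
  is named for (Prop. 5.1 "Lower bound on gaps": `H_{jk} ≤ A·(…)`; Lemma 5.2: `c·(…) ≤ Σ(…)²`;
  Prop. 6.1: `∫ (non-negative) ≤ M·(…)`); `log₊^{O(1)} J` is `logPlus J ^ A` with `A : ℕ`.
* `max_{k ∈ ℤ*: k ≠ j}` is rendered `∀ k ≠ 0, k ≠ j`; finite `ℤ*`-sums over `K` with `k ≠ k'` are
  sums over `K.offDiag` (`K : Finset ℤ`, `0 ∉ K`), as in Lemma 12 (`RodgersTaoZeroDynamics.lean`).
* The infinite cross-energy sum `Σ_{k ∈ K; j ∉ K} E_{jk}(t)` of Lemma 5.2 is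
  `∑ k ∈ K, ∑' j : zstarCompl K, interactionEnergy t j k` with its summability stated in the
  conclusion (the source notes it in the proof, p. 35: "the sum defining `B(t)` is uniformly
  convergent (thanks to (51))"), exactly as Lemma 12 (ii) is typed — so the `∑'` carries no junk.
* `∫_{Λ/2}^0 … dt` of Prop. 6.1 is the interval integral over `[t₀/2, 0]` with the
  interval-integrability of the integrand part of the conclusion, as in the tree's
  `rodgers_tao_integrated_energy_bound` (Thm. 7.2).

## What is NOT here

Thm. 4.1 / Lemma 4.2 (§4: `RodgersTaoZeroDynamics.lean`), Cor. 3.3 (§3), §7; the proof-internal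
display (60) ("enlargement" step) and the largest-gap functional `δ(K)` of the proof of
Prop. 5.1; any CONTENT proof of §§5–6 (the printed arguments live at `t ≤ 0 ≤ Λ`, where the
tree has no real-zero enumeration to run them on). Nothing in this file bears on the truth of
RH: typing a criterion corpus fixes vocabulary, it is not progress toward RH.
-/

noncomputable section

open Set

namespace Literature.NumberTheory.LFunctions

/-! ## The truncated energy of Proposition 6.1 -/

/-- The truncated interaction energy `Σ_{J ≤ j < k ≤ 2J} E_{jk}(t)` integrated in Rodgers–Tao 2020,
Prop. 6.1 (= v5 Prop. 15, FMP p. 38), `J > 0` real: the sum of the tree's `interactionEnergy t j k`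
(display (58)) over the pairs `j < k` of the discrete interval `[J, 2J]_{ℤ*} = zstarIcc ⌈J⌉ ⌊2J⌋`
(integer members of `[J, 2J]`; all positive for `J > 0`). [cite: RodgersTaoFMP2020, Prop. 6.1 = v5 Prop. 15, p. 38] -/
def interactionEnergyDyadicSum (t J : ℝ) : ℝ :=
  ∑ j ∈ zstarIcc ⌈J⌉ ⌊2 * J⌋, ∑ k ∈ (zstarIcc ⌈J⌉ ⌊2 * J⌋).filter (fun k ↦ j < k),
    interactionEnergy t j k

/-- Unfolding lemma for `Σ_{J ≤ j < k ≤ 2J} E_{jk}(t)`. [cite: RodgersTaoFMP2020, Prop. 6.1 = v5 Prop. 15, p. 38] -/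
theorem interactionEnergyDyadicSum_eq (t J : ℝ) :
    interactionEnergyDyadicSum t J =
      ∑ j ∈ zstarIcc ⌈J⌉ ⌊2 * J⌋, ∑ k ∈ (zstarIcc ⌈J⌉ ⌊2 * J⌋).filter (fun k ↦ j < k),
        interactionEnergy t j k := rfl

/-- `Σ_{J ≤ j < k ≤ 2J} E_{jk}(t) ≥ 0` (each `E_{jk} ≥ 0`, `interactionEnergy_nonneg`), so the
integral in Prop. 6.1 is that of a non-negative function. [cite: RodgersTaoFMP2020, Prop. 6.1 = v5 Prop. 15, p. 38] -/
theorem interactionEnergyDyadicSum_nonneg (t J : ℝ) : 0 ≤ interactionEnergyDyadicSum t J :=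
  Finset.sum_nonneg fun _ _ ↦ Finset.sum_nonneg fun _ _ ↦ interactionEnergy_nonneg _ _ _

/-! ## Proposition 5.1 (lower bound on gaps) -/

/-- VACUOUS-AS-PRINTED(Λ ≥ 0) — NAMED FACT. Rodgers–Tao 2020 **Proposition 5.1** (= v5 Prop. 13,
Lower bound on gaps; FMP p. 34, display (59)): «For any `j ∈ ℤ*` and any `Λ/2 ≤ t ≤ 0`, one has
`max_{k ∈ ℤ*: k ≠ j} H_{jk}(t) ≪ (log²₊ j) log₊ log₊ j`», i.e. no zero `x_k(t)` lies within
`exp(−O(log² j · log log j))` of `x_j(t)` ("probably not optimal, but … any bound that grows more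
slowly than (say) `|j|^{0.1}` … would suffice", p. 35). Typed in the house witness form (module
docstring; cell ruling R2): the standing hypothesis `Λ < 0` of §1.2 is a witness `t₀ < 0` with
`H_{t₀}` real-rooted, the range is `t₀/2 ≤ t ≤ 0`, and the constant `A` may depend on `t₀` as the
printed one depends on `Λ` (instance `t₀ = Λ` = the printed clause). Rendering: `≪` one-sided
(an upper bound on `H_{jk}` = `hamiltonianInteraction`, the lower bound on gaps the proposition is
named for); `max_k` as `∀ k`; `log₊ = logPlus`. Inputs of the printed proof (FMP pp. 35–38):
Lemma 5.2, displays (51), (52), (60), compactness for bounded `j`. EX-FALSO class: the witness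
hypothesis contradicts the tree's `Λ ≥ 0`. Users take `(h : rodgers_tao_gap_bound)`.
[cite: RodgersTaoFMP2020, Prop. 5.1 = v5 Prop. 13, p. 34 (59)] -/
def rodgers_tao_gap_bound : Prop :=
  ∀ t₀ : ℝ, t₀ < 0 → HasOnlyRealZeros (deBruijnH t₀) →
    ∃ A : ℝ, ∀ t : ℝ, t₀ / 2 ≤ t → t ≤ 0 →
      ∀ j k : ℤ, j ≠ 0 → k ≠ 0 → k ≠ j →
        hamiltonianInteraction t j k ≤ A * (logPlus j ^ 2 * logPlus (logPlus j))

/-! ## Lemma 5.2 (gaps inside `K` versus the cross energy) -/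

/-- VACUOUS-AS-PRINTED(Λ ≥ 0) — NAMED FACT. Rodgers–Tao 2020 **Lemma 5.2** (= v5 Lemma 14; FMP
p. 35; "a variant of a result in [CSV]"): «Let `K` be a finite subset of `ℤ*` of cardinality
`|K| ≥ 2`, and let `Λ/2 ≤ t ≤ 0`. Then
`Σ_{k,k' ∈ K: k ≠ k'} (x_k(t) − x_{k'}(t))² ≫ |K|³ / (1 + Σ_{k ∈ K; j ∉ K} E_{jk}(t))`»
("the gaps within `K` cannot be too small, unless there is also a small gap between an element of
`K` and an element outside of `K`"). Typed in the house witness form (module docstring; ruling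
R2): witness `t₀ < 0` with `H_{t₀}` real-rooted, range `t₀/2 ≤ t ≤ 0`, constant `c > 0` depending
on `t₀` (the printed proof, FMP pp. 35–36 — Lemma 12 (ii), (iv), Gronwall — uses `t − Λ ≥ |Λ|/2`
and constants depending on `Λ`). Rendering: the cross energy `Σ_{k ∈ K; j ∉ K} E_{jk}(t)`, an
infinite sum over `j ∈ ℤ* ∖ K = zstarCompl K`, is `∑ k ∈ K, ∑' j, interactionEnergy t j k` with
its summability part of the conclusion (proof, p. 35: "the sum defining `B(t)` is uniformly
convergent (thanks to (51))"), as in the tree's Lemma 12 (ii); `≫` one-sided; the left side is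
the sum over ordered pairs `K.offDiag` of `(x_k − x_{k'})²`, `x_k = deBruijnZeroZ t k`. EX-FALSO
class. Users take `(h : rodgers_tao_gap_cross_energy)`.
[cite: RodgersTaoFMP2020, Lemma 5.2 = v5 Lemma 14, p. 35] -/
def rodgers_tao_gap_cross_energy : Prop :=
  ∀ t₀ : ℝ, t₀ < 0 → HasOnlyRealZeros (deBruijnH t₀) →
    ∃ c : ℝ, 0 < c ∧ ∀ t : ℝ, t₀ / 2 ≤ t → t ≤ 0 →
      ∀ K : Finset ℤ, (0 : ℤ) ∉ K → 2 ≤ K.card →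
        (∀ k ∈ K, Summable (fun j : zstarCompl K ↦ interactionEnergy t j k)) ∧
          c * (K.card : ℝ) ^ 3 / (1 + ∑ k ∈ K, ∑' j : zstarCompl K, interactionEnergy t j k) ≤
            ∑ p ∈ K.offDiag, (deBruijnZeroZ t p.1 - deBruijnZeroZ t p.2) ^ 2

/-! ## Proposition 6.1 (weak bound on integrated energy) -/

/-- VACUOUS-AS-PRINTED(Λ ≥ 0) — NAMED FACT. Rodgers–Tao 2020 **Proposition 6.1** (= v5 Prop. 15,
Weak bound on integrated energy; FMP p. 38): «Let `J > 0`. Then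
`∫_{Λ/2}^0 Σ_{J ≤ j < k ≤ 2J} E_{jk}(t) dt ≪ J² log₊^{O(1)} J`» ("while still weak, [it] is at
least of polynomial growth"; used in §7 "to justify an interchange of a derivative and an infinite
series summation"). Typed in the house witness form (module docstring; ruling R2): witness
`t₀ < 0` with `H_{t₀}` real-rooted, the integral taken over `[t₀/2, 0]`, the constant `M` and the
exponent `A : ℕ` (`log₊^{O(1)}`) depending on `t₀`; the interval-integrability of the integrand
`interactionEnergyDyadicSum · J` on `[t₀/2, 0]` (continuous in `t` there by Thm. 4.1) is part of
the conclusion, as in `rodgers_tao_integrated_energy_bound`. Inputs of the printed proof (FMP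
pp. 38–39): Prop. 5.1 at all times of the range, display (52), Lemma 12 (v), the fundamental
theorem of calculus, a pigeonholing over enlargements `K ⊆ K'`. EX-FALSO class. Users take
`(h : rodgers_tao_weak_energy_bound)`. [cite: RodgersTaoFMP2020, Prop. 6.1 = v5 Prop. 15, p. 38] -/
def rodgers_tao_weak_energy_bound : Prop :=
  ∀ t₀ : ℝ, t₀ < 0 → HasOnlyRealZeros (deBruijnH t₀) →
    ∃ (A : ℕ) (M : ℝ), ∀ J : ℝ, 0 < J →
      IntervalIntegrable (fun t ↦ interactionEnergyDyadicSum t J) MeasureTheory.volume (t₀ / 2) 0 ∧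
        ∫ t in (t₀ / 2)..0, interactionEnergyDyadicSum t J ≤ M * (J ^ 2 * logPlus J ^ A)

/-! ## Vacuity record: EX-FALSO discharges (0 content)

The tree proves `Λ ≥ 0` in the `sInf`-free form
`rodgers_tao_holds : ∀ t < 0, ¬ HasOnlyRealZeros (deBruijnH t)` (Dobner's route,
`DobnerLemma4Proofs.lean`), so the witness hypothesis `t₀ < 0 ∧ HasOnlyRealZeros (H_{t₀})` of the
three facts above is unsatisfiable and each holds EX FALSO. These theorems carry NO content of
§§5–6 (cell referee rule F1/F1b: grade X) and exist only to keep vacuous-as-printed statements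
out of the literature-debt queue. -/

/-- EX-FALSO (vacuous range: the witness `t₀ < 0` with `H_{t₀}` real-rooted is refuted by
`rodgers_tao_holds`); 0 content; never to be cited as «Prop. 5.1 formalised».
[cite: RodgersTaoFMP2020, Prop. 5.1 = v5 Prop. 13, p. 34 (59)] -/
theorem rodgers_tao_gap_bound_holds : rodgers_tao_gap_bound :=
  fun t₀ ht₀ h ↦ (rodgers_tao_holds t₀ ht₀ h).elim

/-- EX-FALSO (vacuous range: the witness `t₀ < 0` with `H_{t₀}` real-rooted is refuted by
`rodgers_tao_holds`); 0 content; never to be cited as «Lemma 5.2 formalised».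
[cite: RodgersTaoFMP2020, Lemma 5.2 = v5 Lemma 14, p. 35] -/
theorem rodgers_tao_gap_cross_energy_holds : rodgers_tao_gap_cross_energy :=
  fun t₀ ht₀ h ↦ (rodgers_tao_holds t₀ ht₀ h).elim

/-- EX-FALSO (vacuous range: the witness `t₀ < 0` with `H_{t₀}` real-rooted is refuted by
`rodgers_tao_holds`); 0 content; never to be cited as «Prop. 6.1 formalised».
[cite: RodgersTaoFMP2020, Prop. 6.1 = v5 Prop. 15, p. 38] -/
theorem rodgers_tao_weak_energy_bound_holds : rodgers_tao_weak_energy_bound :=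
  fun t₀ ht₀ h ↦ (rodgers_tao_holds t₀ ht₀ h).elim

end Literature.NumberTheory.LFunctions

end
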